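import Literature.Probability.Percolation.QuadCrossingQuadTopology
import Literature.Probability.Percolation.QuadCrossingContinuityReduction
import Literature.Probability.Percolation.QuadCrossingRawClosed
import Literature.Probability.LatticeModels.MeshDomainBulk
import HarnessLib

/-!
# Continuum duality for the crossing of a quad by the open edges of `δℤ²`

Topic `Probability/Percolation`; proofs file towards Schramm–Smirnov's continuity Lemma 6.1
(`SchrammSmirnov2011_lemma_6_1`, file `QuadCrossingContinuity.lean`; O. Schramm, S. Smirnov, *On the
scaling limits of planar percolation*, Ann. Probab. 39 (2011), arXiv:1101.5820, §6, proof of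
Lemma 6.1: "Duality shows that the latter symmetric difference is the same as `⊞_Q Δ ⊞_{Q'}`";
"The event `¬⊞_Q` would imply that `γ` cannot be connected to `∂₂Q` … Hence, there is a dual closed
crossing from `∂₃Q`").  For a GENERAL quad `Q` the dual event is best expressed with continuum
paths: **`Q` has no crossing inside the drawn open edges `O = openEdgeUnion δ ω` iff some path in
`[Q]` joins `∂₁Q` to `∂₃Q` avoiding `O` and all drawn lattice points** (the lattice points are
added to the obstacle so that dual paths cannot squeeze between two closed edges through their
common vertex — they are isolated points of the obstacle off `O`, so they create no crossing; this
is the form compatible with the face-by-face discretisation `mem_annulusDualCrossing_of_path`).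

* `isClosed_range_meshPoint` — the drawn lattice `δℤ²` is a closed plane set (`δ > 0`);
* `Quad.exists_path_avoiding_of_not_exists_isCrossing` — no open crossing ⇒ a dual path from `∂₁Q`
  to `∂₃Q` in `[Q]` off `O ∪ δℤ²` (the dual-path theorem `Quad.exists_path_avoiding_of_not_crossed`
  applied to the obstacle `(O ∪ δℤ²) ∩ [Q]`, whose connected subsets meeting two opposite sides lie
  in `O`, `subset_openEdgeUnion_of_isPreconnected`);
* `Quad.not_exists_isCrossing_of_path_avoiding` — conversely such a dual path excludes every open
  crossing (crossing lemma `Quad.exists_mem_of_isPreconnected_crossing`);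
* the primed versions with the pairs of sides exchanged (open crossings `∂₁Q ↔ ∂₃Q` versus dual
  paths `∂₀Q ↔ ∂₂Q`), for the duality steps of cases (1) and (3).

## References

* O. Schramm, S. Smirnov, Ann. Probab. 39 (2011) 1768–1814, arXiv:1101.5820, proof of Lemma 6.1.
  [SchrammSmirnov2011]
* G. Grimmett, *Percolation*, 2nd ed. (1999), §11.2 (planar duality). [GrimmettPercolation1999]
-/

noncomputable section

open scoped unitInterval
open Set Filter Metric Function
open _root_.Topology
open Literature.Probability.LatticeModels

namespace Literature.Probability.Percolation

namespace QuadCrossing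

variable {D : Set ℂ} {δ : ℝ} {ω : BondConfig (Site 2)}

/-! ### The drawn lattice points -/

/-- The drawn lattice `δℤ² = {meshPoint δ v}` is a closed plane set (`δ > 0`): distinct lattice
points are drawn at distance `≥ δ`. [folklore] -/
theorem isClosed_range_meshPoint (hδ : 0 < δ) : IsClosed (range (meshPoint δ)) := by
  refine isClosed_of_pairwise_le_dist hδ ?_
  rintro _ ⟨u, rfl⟩ _ ⟨v, rfl⟩ hne
  exact le_dist_meshPoint_of_ne hδ fun h => hne (h ▸ rfl)

/-- Near a drawn lattice point off the open edges, the obstacle `O ∪ δℤ²` reduces to that point: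
there is `r > 0` with `B(p, r) ∩ (O ∪ δℤ²) ⊆ {p}`. [folklore] -/
theorem exists_ball_inter_subset_singleton (hδ : 0 < δ) {v : Site 2}
    (hv : meshPoint δ v ∉ openEdgeUnion δ ω) :
    ∃ r > 0, ball (meshPoint δ v) r ∩ (openEdgeUnion δ ω ∪ range (meshPoint δ)) ⊆ {meshPoint δ v} := by
  obtain ⟨r₁, hr₁, hball⟩ := Metric.isOpen_iff.1 (isClosed_openEdgeUnion hδ ω).isOpen_compl _ hv
  refine ⟨min r₁ δ, lt_min hr₁ hδ, ?_⟩
  rintro z ⟨hz, hzO | ⟨w, rfl⟩⟩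
  · exact absurd hzO (hball (ball_subset_ball (min_le_left _ _) hz))
  · by_contra hne
    have hne' : w ≠ v := fun h => hne (by rw [h]; rfl)
    have h1 : δ ≤ dist (meshPoint δ w) (meshPoint δ v) := le_dist_meshPoint_of_ne hδ hne'
    have h2 : dist (meshPoint δ w) (meshPoint δ v) < min r₁ δ := hz
    exact (lt_irrefl δ) (h1.trans_lt (h2.trans_le (min_le_right _ _)))

/-- **A connected piece of the obstacle with two points lies in the open edges.**  If
`C ⊆ O ∪ δℤ²` is preconnected and contains two distinct points, then `closure C ⊆ O`: a drawn
lattice point off `O` is an isolated point of the obstacle, and a preconnected set with two points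
has no isolated point. [folklore] -/
theorem closure_subset_openEdgeUnion_of_isPreconnected (hδ : 0 < δ) {C : Set ℂ}
    (hC : IsPreconnected C) (hCsub : C ⊆ openEdgeUnion δ ω ∪ range (meshPoint δ))
    {a b : ℂ} (ha : a ∈ C) (hb : b ∈ C) (hab : a ≠ b) : closure C ⊆ openEdgeUnion δ ω := by
  intro p hp
  by_contra hpO
  have hpK : p ∈ openEdgeUnion δ ω ∪ range (meshPoint δ) :=
    ((isClosed_openEdgeUnion hδ ω).union (isClosed_range_meshPoint hδ)).closure_subset_iff.2 hCsub hp
  obtain ⟨v, rfl⟩ : p ∈ range (meshPoint δ) := hpK.resolve_left hpO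
  obtain ⟨r, hr, hloc⟩ := exists_ball_inter_subset_singleton hδ hpO
  -- `C ∩ B(p, r) ⊆ {p}`, and `C` meets `B(p, r)`
  have hCball : C ∩ ball (meshPoint δ v) r ⊆ {meshPoint δ v} := fun z ⟨hzC, hzb⟩ =>
    hloc ⟨hzb, hCsub hzC⟩
  obtain ⟨z, hzC, hzb⟩ := Metric.mem_closure_iff.1 hp r hr
  have hzp : z = meshPoint δ v := hCball ⟨hzC, mem_ball'.2 hzb⟩
  subst hzp
  -- a second point of `C` is far from `p`
  obtain ⟨q, hqC, hqp⟩ : ∃ q ∈ C, q ≠ meshPoint δ v := by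
    by_cases h : a = meshPoint δ v
    · exact ⟨b, hb, fun h' => hab (h.trans h'.symm)⟩
    · exact ⟨a, ha, h⟩
  have hqfar : r ≤ dist q (meshPoint δ v) := by
    by_contra h
    push Not at h
    exact hqp (hCball ⟨hqC, h⟩)
  -- preconnectedness with `u = B(p, r)`, `v = (closedBall p (r/2))ᶜ`
  obtain ⟨w, hwC, hwu, hwv⟩ := hC (ball (meshPoint δ v) r) (closedBall (meshPoint δ v) (r / 2))ᶜ
    isOpen_ball isClosed_closedBall.isOpen_compl (fun w _ => by
      by_cases hw : dist w (meshPoint δ v) < r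
      · exact Or.inl hw
      · right
        simp only [mem_compl_iff, mem_closedBall, not_le]
        push Not at hw
        linarith)
    ⟨meshPoint δ v, hzC, mem_ball_self hr⟩
    ⟨q, hqC, by simp only [mem_compl_iff, mem_closedBall, not_le]; linarith⟩
  have hwp : w = meshPoint δ v := hCball ⟨hwC, hwu⟩
  subst hwp
  simp only [mem_compl_iff, mem_closedBall, dist_self, not_le] at hwv
  linarith

namespace Quad

/-! ### Duality: no open crossing iff a dual path between the other two sides -/

/-- **No open crossing ⇒ a dual path** (continuum planar duality in a general quad).  If `Q` has no
crossing inside the drawn open edges `O = openEdgeUnion δ ω` (`δ > 0`), then some path in `[Q]`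
joins `∂₁Q` to `∂₃Q` avoiding `O` and every drawn lattice point ("Hence, there is a dual closed
crossing" in the proof of Schramm–Smirnov's Lemma 6.1; the lattice shadow of such a path is a
dual-open chain of faces, `mem_annulusDualCrossing_of_path`).
[cite: SchrammSmirnov2011, proof of Lemma 6.1] -/
theorem exists_path_avoiding_of_not_exists_isCrossing (Q : Quad D) (hδ : 0 < δ)
    (h : ¬ ∃ K, Q.IsCrossing K ∧ K ⊆ openEdgeUnion δ ω) :
    ∃ β : ℝ → ℂ, ContinuousOn β (Icc 0 1) ∧ MapsTo β (Icc 0 1) Q.carrier ∧ β 0 ∈ Q.side 1 ∧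
      β 1 ∈ Q.side 3 ∧ ∀ t ∈ Icc (0 : ℝ) 1,
        β t ∉ openEdgeUnion δ ω ∧ β t ∉ range (meshPoint δ) := by
  set 𝒦 : Set ℂ := (openEdgeUnion δ ω ∪ range (meshPoint δ)) ∩ Q.carrier with h𝒦
  have h𝒦c : IsCompact 𝒦 :=
    Q.isCompact_carrier.inter_left ((isClosed_openEdgeUnion hδ ω).union (isClosed_range_meshPoint hδ))
  obtain ⟨β, hβc, hβm, hβ0, hβ1, hβ𝒦⟩ := Q.exists_path_avoiding_of_not_crossed h𝒦c inter_subset_right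
    (fun C hC hCc hC0 hC2 => by
      obtain ⟨a, haC, ha0⟩ := hC0
      obtain ⟨b, hbC, hb2⟩ := hC2
      have hab : a ≠ b := fun heq =>
        Set.disjoint_left.1 (Q.disjoint_side_side_add_two 0) ha0 (heq ▸ hb2)
      have hcl : closure C ⊆ openEdgeUnion δ ω := closure_subset_openEdgeUnion_of_isPreconnected hδ
        hCc (hC.trans inter_subset_left) haC hbC hab
      refine h ⟨closure C, ⟨?_, ?_, ?_, ?_, ?_⟩, hcl⟩
      · exact h𝒦c.of_isClosed_subset isClosed_closure (h𝒦c.isClosed.closure_subset_iff.2 hC)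
      · exact ⟨⟨a, subset_closure haC⟩, hCc.closure⟩
      · exact (h𝒦c.isClosed.closure_subset_iff.2 hC).trans inter_subset_right
      · exact ⟨a, subset_closure haC, ha0⟩
      · exact ⟨b, subset_closure hbC, hb2⟩)
  refine ⟨β, hβc, hβm, hβ0, hβ1, fun t ht => ?_⟩
  have hnot : β t ∉ 𝒦 := hβ𝒦 t ht
  rw [h𝒦] at hnot
  simp only [mem_inter_iff, mem_union, not_and] at hnot
  have := fun h' => hnot h' (hβm ht)
  exact ⟨fun h1 => this (Or.inl h1), fun h2 => this (Or.inr h2)⟩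

/-- **A dual path excludes open crossings.**  If some path in `[Q]` joins `∂₁Q` to `∂₃Q` off the
drawn open edges, then `Q` has no crossing inside them (the crossing, a continuum from `∂₀Q` to
`∂₂Q`, would meet the path). [cite: SchrammSmirnov2011, proof of Lemma 6.1] -/
theorem not_exists_isCrossing_of_path_avoiding (Q : Quad D) {β : ℝ → ℂ}
    (hβ : ContinuousOn β (Icc 0 1)) (hβQ : MapsTo β (Icc 0 1) Q.carrier) (hβ0 : β 0 ∈ Q.side 1)
    (hβ1 : β 1 ∈ Q.side 3) (hβO : ∀ t ∈ Icc (0 : ℝ) 1, β t ∉ openEdgeUnion δ ω) :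
    ¬ ∃ K, Q.IsCrossing K ∧ K ⊆ openEdgeUnion δ ω := by
  rintro ⟨K, ⟨hKc, hKconn, hKsub, hK0, hK2⟩, hKO⟩
  obtain ⟨t, ht, htK⟩ := Q.exists_mem_of_isPreconnected_crossing hKc hKconn.isPreconnected hKsub hK0
    hK2 hβ hβQ hβ0 hβ1
  exact hβO t ht (hKO htK)

/-- **Exact duality**, the two statements combined: `Q` has no open crossing iff some path in `[Q]`
from `∂₁Q` to `∂₃Q` avoids the open edges and the drawn lattice points.
[cite: SchrammSmirnov2011, proof of Lemma 6.1] -/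
theorem not_exists_isCrossing_iff_exists_path_avoiding (Q : Quad D) (hδ : 0 < δ) :
    (¬ ∃ K, Q.IsCrossing K ∧ K ⊆ openEdgeUnion δ ω) ↔
      ∃ β : ℝ → ℂ, ContinuousOn β (Icc 0 1) ∧ MapsTo β (Icc 0 1) Q.carrier ∧ β 0 ∈ Q.side 1 ∧
        β 1 ∈ Q.side 3 ∧ ∀ t ∈ Icc (0 : ℝ) 1,
          β t ∉ openEdgeUnion δ ω ∧ β t ∉ range (meshPoint δ) :=
  ⟨Q.exists_path_avoiding_of_not_exists_isCrossing hδ, fun ⟨_, hβc, hβm, hβ0, hβ1, hβO⟩ =>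
    Q.not_exists_isCrossing_of_path_avoiding hβc hβm hβ0 hβ1 fun t ht => (hβO t ht).1⟩

/-- The same duality with the two pairs of sides exchanged: **no open continuum in `[Q]` joining
`∂₁Q` to `∂₃Q` iff some path in `[Q]` from `∂₀Q` to `∂₂Q` avoids the open edges and the drawn
lattice points** (through the transposed quad).  This is the form behind "duality shows that the
latter symmetric difference is the same as `⊞_Q Δ ⊞_{Q'}`" (case (1), `d = d₁`) and the reduction of
case (3) to case (2). [cite: SchrammSmirnov2011, proof of Lemma 6.1] -/
theorem not_exists_isCrossing_transpose_iff (Q : Quad D) (hδ : 0 < δ) :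
    (¬ ∃ K, IsCompact K ∧ IsConnected K ∧ K ⊆ Q.carrier ∧ (K ∩ Q.side 1).Nonempty ∧
        (K ∩ Q.side 3).Nonempty ∧ K ⊆ openEdgeUnion δ ω) ↔
      ∃ β : ℝ → ℂ, ContinuousOn β (Icc 0 1) ∧ MapsTo β (Icc 0 1) Q.carrier ∧ β 0 ∈ Q.side 0 ∧
        β 1 ∈ Q.side 2 ∧ ∀ t ∈ Icc (0 : ℝ) 1,
          β t ∉ openEdgeUnion δ ω ∧ β t ∉ range (meshPoint δ) := by
  obtain ⟨Qt, hcar, ht0, ht1, ht2, ht3⟩ := Q.exists_transpose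
  have key := Qt.not_exists_isCrossing_iff_exists_path_avoiding (ω := ω) hδ
  rw [hcar, ht1, ht3] at key
  have hiff : (∃ K, Qt.IsCrossing K ∧ K ⊆ openEdgeUnion δ ω) ↔
      ∃ K, IsCompact K ∧ IsConnected K ∧ K ⊆ Q.carrier ∧ (K ∩ Q.side 1).Nonempty ∧
        (K ∩ Q.side 3).Nonempty ∧ K ⊆ openEdgeUnion δ ω := by
    simp only [Quad.IsCrossing, hcar, ht0, ht2, and_assoc]
  rw [hiff] at key
  exact key

end Quad

end QuadCrossing

end Literature.Probability.Percolation
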